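import Mathlib.AlgebraicGeometry.AlgClosed.Basic
import Mathlib.AlgebraicGeometry.Morphisms.UniversallyInjective
import Literature.AlgebraicGeometry.Resolution.FiniteBirationalNormal
import Literature.AlgebraicGeometry.Morphisms.FiniteOfClosedFibres
import Literature.AlgebraicGeometry.Motives.AbelianVarietyKernelComponent
import HarnessLib

/-!
# A closed graph over a normal variety is the graph of a morphism (characteristic zero)

Let `K` be an algebraically closed field of characteristic `0`, `T` an integral NORMAL `K`-scheme
locally of finite type (all local rings integrally closed), `P` a proper `K`-scheme,
`φ₀ : T(K) → P(K)` a map of `K`-points and `Γ ⊆ T ×_K P` a CLOSED subset whose `K`-points are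
exactly the pairs `(x, φ₀ x)`. Then there is a morphism of `K`-schemes `ψ : T → P` with
`x ≫ ψ = φ₀ x` for every `K`-point `x` (`exists_hom_forall_comp_eq_of_isClosed`), and it is unique
(`SchemeOver.hom_ext_of_forall_algPoints` of `Motives/AlgPointsSeparate`: `K`-points separate
morphisms from a reduced `K`-scheme locally of finite type to a separated one). This is the
scheme-theoretic form of the classical principle that a
map of varieties which is "algebraic" in the sense that its graph is closed is a morphism as soon as
the source is normal and the ground field has characteristic zero — the tool by which morphisms are
built from point-set recipes in Weil-style constructions (in this tree: the linear-system morphisms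
of Weil's construction of the Jacobian, Milne, *Jacobian Varieties*, §7). In characteristic `p > 0`
the graph of `x ↦ x^{1/p}` on `𝔸¹` is a counterexample, and without normality the normalisation of
the cusp `Spec K[t², t³]` is one.

## The proof

Let `G ↪ T ×_K P` be the reduced closed subscheme on `Γ` (Mathlib `(vanishingIdeal Γ).subscheme`)
and `π : G → T` the projection.

1. Over a closed point `t` of `T` (the point of a `K`-point `x`, Nullstellensatz) the set `Γ` has
   exactly ONE point, the point of `(x, φ₀ x)`: the closed set `Γ ∩ pr₁⁻¹(t)` is the closure of its
   closed points (`T ×_K P` is Jacobson), and its closed points are `K`-points `(x, y)` with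
   `y = φ₀ x` (`eq_pt_lift_of_mem`).
2. `π` is proper with finite fibres over the closed points of the Jacobson scheme `T`, hence FINITE
   (Görtz–Wedhorn I, Cor. 12.89 — a form of Zariski's Main Theorem; the tree's
   `Morphisms.isFinite_of_isProper_of_finite_preimage_closedPoint`), and surjective (`surjective_grπ`).
3. `G` is irreducible — of two closed subsets covering `G` one maps onto the irreducible `T`, and a
   closed subset mapping onto `T` contains every closed point of `G` by 1
   (`eq_univ_of_isClosed_of_image_eq`), hence is `G` — so `G` is INTEGRAL (`isIntegral_grS`).
4. The diagonal `G → G ×_T G` is surjective: its (closed) image contains every closed point, because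
   the two projections of a `K`-point of `G ×_T G` are `K`-points of `G` over the same point of `T`,
   equal by 1 (`surjective_diagonal_grπ`). Hence `π` is universally injective, i.e. radicial: its
   residue field extensions are purely inseparable (Stacks 01S4, Mathlib `tfae_universallyInjective`);
   in particular `K(T) → K(G)` is purely inseparable, hence — in characteristic zero — an
   ISOMORPHISM (`isIso_stalkMap_grπ_genericPoint`).
5. A finite birational morphism onto a normal integral scheme is an isomorphism (Görtz–Wedhorn I,
   Cor. 12.88; the tree's `Resolution.isIso_morphismRestrict_of_isIntegralHom_of_isIso_stalkMap`):
   `π : G ≅ T` (`isIso_grπ`), and `ψ := π⁻¹ ≫ (G ↪ T ×_K P) ≫ pr₂`.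

Everything is proved; there are no definitions and no named facts (the subscheme `G`, its
immersion and `π` are written out as `(vanishingIdeal Z).subscheme`, `(vanishingIdeal Z).subschemeι`,
`(vanishingIdeal Z).subschemeι ≫ (fst T P).left` for `Z : Closeds (T ×_K P)`). Also recorded:
small facts on `K`-points over an algebraically closed field (`AlgPoints.isClosed_singleton_pt`,
`AlgPoints.eq_of_pt_eq`, `AlgPoints.exists_pt_eq_of_isClosed_singleton`), after Mathlib's
`pointEquivClosedPoint`.

Mathlib searched (pin): `tfae_universallyInjective` (Stacks 01S4),
`IsPurelyInseparable.surjective_algebraMap_of_isSeparable`, `Algebra.IsSeparable.of_integral`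
(characteristic `0`), `pointOfClosedPoint`, `ext_of_apply_closedPoint_eq`,
`JacobsonSpace.closure_inter_closedPoints_eq_closure`, `closure_closedPoints`,
`isPreirreducible_iff_isClosed_union_isClosed`, `IsClosedImmersion.lift`,
`Scheme.residue_residueFieldMap`, `IsLocalRing.isField_iff_maximalIdeal_eq` (all used); Mathlib has
Zariski's Main Theorem (`Mathlib.AlgebraicGeometry.ZariskisMainTheorem`) but not this closed-graph
statement.

## References

* U. Görtz, T. Wedhorn, *Algebraic Geometry I: Schemes*, 2nd ed. (2020), Cor. 12.88 (separated
  quasi-finite birational onto normal is an open immersion), Cor. 12.89 (finite ⟺ quasi-finite and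
  proper). [GortzWedhorn2020]
* The Stacks Project, Tag 01S4 (universally injective ⟺ radicial), Tag 0AB1. [StacksProject]
* J. S. Milne, *Jacobian Varieties*, in Cornell–Silverman (eds.), *Arithmetic Geometry* (1986), §7
  (Weil's construction, where such morphisms are needed). [Milne1986JacobianVarieties]
-/

noncomputable section

universe u

open CategoryTheory CategoryTheory.Limits AlgebraicGeometry TopologicalSpace Topology
  MonoidalCategory CartesianMonoidalCategory Scheme.IdealSheafData

namespace Literature.AlgebraicGeometry.Motives

section KPoints

variable {K : Type u} [Field K] {X : SchemeOver K}

/-- A `K`-point over `K` is a section of the structure morphism: `z ≫ (X → Spec K) = 𝟙`.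
[folklore] -/
private theorem AlgPoints.left_comp_hom_eq_id' (z : AlgPoints X K) : z.left ≫ X.hom = 𝟙 _ := by
  rw [Over.w z]
  change Spec.map (CommRingCat.ofHom (algebraMap K K)) = 𝟙 _
  rw [Algebra.algebraMap_self, CommRingCat.ofHom_id, Spec.map_id]

/-- The point of a `K`-rational point is closed (a section of `X → Spec K` is a closed immersion;
cf. `Literature.AlgebraicGeometry.Motives.isClosed_singleton_pt` of `Motives/OpenImmersionGraph`, not
imported here to keep the Chow-group development out of the imports). [folklore] -/
theorem AlgPoints.isClosed_singleton_pt (z : AlgPoints X K) :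
    IsClosed ({z.pt} : Set X.left) := by
  haveI : IsClosedImmersion z.left := isClosedImmersion_of_comp_eq_id X.hom z.left z.left_comp_hom_eq_id'
  haveI : Unique ↥(specOver K K).left := inferInstanceAs (Unique (PrimeSpectrum K))
  have hr : Set.range z.left = {z.pt} := by
    ext p
    constructor
    · rintro ⟨a, rfl⟩
      rw [Subsingleton.elim a (IsLocalRing.closedPoint K)]
      rfl
    · rintro rfl
      exact ⟨IsLocalRing.closedPoint K, rfl⟩
  rw [← hr]
  exact z.left.isClosedEmbedding.isClosed_range

variable [IsAlgClosed K] [LocallyOfFiniteType X.hom]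

/-- Over an algebraically closed field, `K`-points of a `K`-scheme locally of finite type with the
same underlying (closed) point are equal (Mathlib `ext_of_apply_closedPoint_eq`: the residue field of
a closed point is `K`). [folklore] -/
theorem AlgPoints.eq_of_pt_eq {z z' : AlgPoints X K} (h : z.pt = z'.pt) : z = z' := by
  ext : 1
  exact ext_of_apply_closedPoint_eq X.hom z.left_comp_hom_eq_id' z'.left_comp_hom_eq_id' h

/-- Over an algebraically closed field every closed point of a `K`-scheme locally of finite type
underlies a `K`-point (Mathlib `pointOfClosedPoint`, Hilbert's Nullstellensatz). [folklore] -/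
theorem AlgPoints.exists_pt_eq_of_isClosed_singleton {x : X.left} (hx : IsClosed ({x} : Set X.left)) :
    ∃ z : AlgPoints X K, z.pt = x := by
  refine ⟨AlgPoints.mk (pointOfClosedPoint X.hom x hx) ?_, ?_⟩
  · rw [pointOfClosedPoint_comp]
    change 𝟙 _ = Spec.map (CommRingCat.ofHom (algebraMap K K))
    rw [Algebra.algebraMap_self, CommRingCat.ofHom_id, Spec.map_id]
  · exact pointOfClosedPoint_apply X.hom x hx _

/-- Closed points = points of `K`-points, over an algebraically closed field (Mathlib
`pointEquivClosedPoint`). [folklore] -/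
theorem AlgPoints.isClosed_singleton_iff_exists_pt_eq (x : X.left) :
    IsClosed ({x} : Set X.left) ↔ ∃ z : AlgPoints X K, z.pt = x :=
  ⟨AlgPoints.exists_pt_eq_of_isClosed_singleton, by rintro ⟨z, rfl⟩; exact z.isClosed_singleton_pt⟩

end KPoints

/-! ### The reduced closed subscheme on a closed graph -/

namespace ClosedGraph

variable {K : Type u} [Field K] {T P : SchemeOver K} (Z : Closeds ↥(T ⊗ P).left)

/-- Points of `G` map into `Γ`. [folklore] -/
theorem grι_mem (g : ↥((vanishingIdeal Z).subscheme)) : (vanishingIdeal Z).subschemeι g ∈ (Z : Set ↥(T ⊗ P).left) := by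
  have h : (vanishingIdeal Z).subschemeι g ∈ Set.range ((vanishingIdeal Z).subschemeι) := ⟨g, rfl⟩
  rwa [Resolution.ComponentGluing.range_subschemeι_vanishingIdeal Z] at h

/-- `G ↪ T ×_K P` is injective on points. [folklore] -/
theorem grι_injective : Function.Injective ((vanishingIdeal Z).subschemeι) := ((vanishingIdeal Z).subschemeι).isClosedEmbedding.injective

/-- `G` is reduced (its affine pieces are spectra of quotients by radical ideals): the special case
`X := T ×_K P` of `Resolution.ComponentGluing.isReduced_subscheme_vanishingIdeal` (the reduced
induced structure on a closed subset is reduced); kept as a deprecated alias. [folklore] -/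
@[deprecated Resolution.ComponentGluing.isReduced_subscheme_vanishingIdeal (since := "2026-08-17")]
alias isReduced_grS := Resolution.ComponentGluing.isReduced_subscheme_vanishingIdeal

/-- `π : G → T` is proper (`P` is proper over `K`). [folklore] -/
theorem isProper_grπ [IsProper P.hom] : IsProper ((vanishingIdeal Z).subschemeι ≫ (fst T P).left) := by
  have : IsProper (fst T P).left := by
    change IsProper (pullback.fst T.hom P.hom); infer_instance
  infer_instance

/-- `π` is a morphism over `K`. [folklore] -/
theorem grπ_comp_hom : ((vanishingIdeal Z).subschemeι ≫ (fst T P).left) ≫ T.hom = ((vanishingIdeal Z).subschemeι ≫ (T ⊗ P).hom) := by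
  rw [Category.assoc, Over.w (fst T P)]

/-! ### The fibres over the closed points -/

variable [IsAlgClosed K] (φ₀ : AlgPoints T K → AlgPoints P K)
  (hΓφ : ∀ (x : AlgPoints T K) (y : AlgPoints P K),
    AlgPoints.pt (lift x y : AlgPoints (T ⊗ P) K) ∈ (Z : Set ↥(T ⊗ P).left) ↔ y = φ₀ x)

omit [IsAlgClosed K] in
/-- The point of the `K`-point `(x, y)` lies over the point of `x`. [folklore] -/
theorem fst_pt_lift (x : AlgPoints T K) (y : AlgPoints P K) :
    (fst T P).left (AlgPoints.pt (lift x y : AlgPoints (T ⊗ P) K)) = x.pt := by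
  rw [← AlgPoints.pt_map, AlgPoints.map_apply, lift_fst]

include hΓφ in
/-- **One point of `Γ` over each closed point.** Every point of `Γ` lying over the (closed) point of
a `K`-point `x` of `T` is the point of the `K`-point `(x, φ₀ x)`. [folklore] -/
theorem eq_pt_lift_of_mem [LocallyOfFiniteType T.hom] [LocallyOfFiniteType P.hom]
    (x : AlgPoints T K) {γ : ↥(T ⊗ P).left} (hγ : γ ∈ (Z : Set ↥(T ⊗ P).left)) (hγx : (fst T P).left γ = x.pt) :
    γ = AlgPoints.pt (lift x (φ₀ x) : AlgPoints (T ⊗ P) K) := by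
  haveI : JacobsonSpace ↥(T ⊗ P).left := LocallyOfFiniteType.jacobsonSpace (T ⊗ P).hom
  -- the closed set of points of `Γ` over `x`
  set S : Set ↥(T ⊗ P).left := (Z : Set ↥(T ⊗ P).left) ∩ (fst T P).left ⁻¹' {x.pt} with hS
  have hScl : IsClosed S := IsClosed.inter Z.isClosed (IsClosed.preimage (fst T P).left.continuous
    (AlgPoints.isClosed_singleton_pt x))
  have hγS : γ ∈ S := ⟨hγ, hγx⟩
  -- its closed points are all equal to the point of `(x, φ₀ x)`
  have hsub : S ∩ closedPoints ↥(T ⊗ P).left ⊆ {AlgPoints.pt (lift x (φ₀ x) : AlgPoints (T ⊗ P) K)} := by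
    rintro δ ⟨⟨hδΓ, hδx⟩, hδcl⟩
    obtain ⟨z, rfl⟩ := AlgPoints.exists_pt_eq_of_isClosed_singleton (X := T ⊗ P) (mem_closedPoints_iff.mp hδcl)
    have hx : z ≫ fst T P = x := by
      apply AlgPoints.eq_of_pt_eq
      rw [← AlgPoints.map_apply, AlgPoints.pt_map]
      exact hδx
    have hz : z = lift (z ≫ fst T P) (z ≫ snd T P) := by simp
    rw [hz, hx] at hδΓ
    have hy : z ≫ snd T P = φ₀ x := (hΓφ x _).mp hδΓ
    rw [Set.mem_singleton_iff, hz, hx, hy]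
  have hcl : closure (S ∩ closedPoints ↥(T ⊗ P).left) = S := by
    rw [JacobsonSpace.closure_inter_closedPoints_eq_closure hScl.isLocallyClosed, hScl.closure_eq]
  have : S ⊆ {AlgPoints.pt (lift x (φ₀ x) : AlgPoints (T ⊗ P) K)} := by
    rw [← hcl]
    exact closure_minimal hsub (AlgPoints.isClosed_singleton_pt _)
  exact this hγS

include hΓφ in
/-- The fibres of `π : G → T` over closed points are subsingletons. [folklore] -/
theorem subsingleton_preimage_grπ [LocallyOfFiniteType T.hom] [LocallyOfFiniteType P.hom]
    {t : T.left} (ht : IsClosed ({t} : Set T.left)) : (((vanishingIdeal Z).subschemeι ≫ (fst T P).left) ⁻¹' {t}).Subsingleton := by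
  obtain ⟨x, rfl⟩ := AlgPoints.exists_pt_eq_of_isClosed_singleton ht
  intro g hg g' hg'
  apply grι_injective Z
  rw [eq_pt_lift_of_mem Z φ₀ hΓφ x (grι_mem Z g) hg,
    eq_pt_lift_of_mem Z φ₀ hΓφ x (grι_mem Z g') hg']

include hΓφ in
/-- Every closed point of `T` has a point of `G` over it. [folklore] -/
theorem exists_grπ_eq [LocallyOfFiniteType T.hom] [LocallyOfFiniteType P.hom]
    {t : T.left} (ht : IsClosed ({t} : Set T.left)) : ∃ g : ↥((vanishingIdeal Z).subscheme), ((vanishingIdeal Z).subschemeι ≫ (fst T P).left) g = t := by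
  obtain ⟨x, rfl⟩ := AlgPoints.exists_pt_eq_of_isClosed_singleton ht
  have hmem : AlgPoints.pt (lift x (φ₀ x) : AlgPoints (T ⊗ P) K) ∈ Set.range ((vanishingIdeal Z).subschemeι) := by
    rw [Resolution.ComponentGluing.range_subschemeι_vanishingIdeal Z]; exact (hΓφ x _).mpr rfl
  obtain ⟨g, hg⟩ := hmem
  exact ⟨g, by rw [Scheme.Hom.comp_apply, hg, fst_pt_lift]⟩

include hΓφ in
/-- `π : G → T` is finite (proper with finite fibres over the closed points of the Jacobson scheme `T`). [folklore] -/
theorem isFinite_grπ [LocallyOfFiniteType T.hom] [IsProper P.hom] : IsFinite (((vanishingIdeal Z).subschemeι ≫ (fst T P).left)) := by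
  haveI : JacobsonSpace ↥T.left := LocallyOfFiniteType.jacobsonSpace T.hom
  haveI := isProper_grπ Z
  exact Morphisms.isFinite_of_isProper_of_finite_preimage_closedPoint _ fun t ht ↦
    Set.Subsingleton.finite (subsingleton_preimage_grπ Z φ₀ hΓφ ht)

include hΓφ in
/-- `π : G → T` is surjective (closed image containing all closed points). [folklore] -/
theorem surjective_grπ [LocallyOfFiniteType T.hom] [IsProper P.hom] : Surjective (((vanishingIdeal Z).subschemeι ≫ (fst T P).left)) := by
  haveI : JacobsonSpace ↥T.left := LocallyOfFiniteType.jacobsonSpace T.hom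
  haveI := isProper_grπ Z
  refine ⟨fun t ↦ ?_⟩
  have hcl : IsClosed (Set.range (((vanishingIdeal Z).subschemeι ≫ (fst T P).left))) := (((vanishingIdeal Z).subschemeι ≫ (fst T P).left)).isClosedMap.isClosed_range
  have hsub : closedPoints ↥T.left ⊆ Set.range (((vanishingIdeal Z).subschemeι ≫ (fst T P).left)) := fun t ht ↦
    exists_grπ_eq Z φ₀ hΓφ (mem_closedPoints_iff.mp ht)
  have : Set.range (((vanishingIdeal Z).subschemeι ≫ (fst T P).left)) = Set.univ := by
    apply Set.eq_univ_of_univ_subset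
    rw [← closure_closedPoints (X := ↥T.left)]
    exact closure_minimal hsub hcl
  have ht : t ∈ Set.range (((vanishingIdeal Z).subschemeι ≫ (fst T P).left)) := this ▸ Set.mem_univ t
  exact ht

include hΓφ in
/-- A closed subset of `G` mapping onto `T` is all of `G` (its complement contains no closed point). [folklore] -/
theorem eq_univ_of_isClosed_of_image_eq [LocallyOfFiniteType T.hom] [IsProper P.hom]
    {C : Set ↥((vanishingIdeal Z).subscheme)} (hC : IsClosed C)
    (hCT : ((vanishingIdeal Z).subschemeι ≫ (fst T P).left) '' C = Set.univ) : C = Set.univ := by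
  haveI : JacobsonSpace ↥((vanishingIdeal Z).subscheme) := LocallyOfFiniteType.jacobsonSpace (((vanishingIdeal Z).subschemeι ≫ (T ⊗ P).hom))
  haveI := isProper_grπ Z
  have hsub : closedPoints ↥((vanishingIdeal Z).subscheme) ⊆ C := fun g hg ↦ by
    have hgcl : IsClosed ({g} : Set ↥((vanishingIdeal Z).subscheme)) := mem_closedPoints_iff.mp hg
    have htcl : IsClosed ({((vanishingIdeal Z).subschemeι ≫ (fst T P).left) g} : Set T.left) := by
      rw [← Set.image_singleton]; exact (((vanishingIdeal Z).subschemeι ≫ (fst T P).left)).isClosedMap _ hgcl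
    obtain ⟨g', hg'C, hg'⟩ : ((vanishingIdeal Z).subschemeι ≫ (fst T P).left) g ∈
        ((vanishingIdeal Z).subschemeι ≫ (fst T P).left) '' C := hCT ▸ Set.mem_univ _
    rwa [subsingleton_preimage_grπ Z φ₀ hΓφ htcl (Set.mem_singleton _) hg']
  apply Set.eq_univ_of_univ_subset
  rw [← closure_closedPoints (X := ↥((vanishingIdeal Z).subscheme)), ← hC.closure_eq]
  exact closure_mono hsub

include hΓφ in
/-- `G` is irreducible: of two closed subsets covering `G` one maps onto the irreducible `T`. [folklore] -/
theorem irreducibleSpace_grS [IsIntegral T.left] [LocallyOfFiniteType T.hom] [IsProper P.hom] :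
    IrreducibleSpace ↥((vanishingIdeal Z).subscheme) := by
  haveI : JacobsonSpace ↥T.left := LocallyOfFiniteType.jacobsonSpace T.hom
  have hsurj := surjective_grπ Z φ₀ hΓφ
  haveI := isProper_grπ Z
  -- non-empty: a closed point of `T` has a point of `G` over it
  obtain ⟨t, -, ht⟩ := nonempty_inter_closedPoints (Set.univ_nonempty (α := ↥T.left))
    isClosed_univ.isLocallyClosed
  obtain ⟨g₀, -⟩ := exists_grπ_eq Z φ₀ hΓφ (mem_closedPoints_iff.mp ht)
  have hpre : IsPreirreducible (Set.univ : Set ↥((vanishingIdeal Z).subscheme)) := by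
    refine isPreirreducible_iff_isClosed_union_isClosed.mpr fun Z₁ Z₂ hZ₁ hZ₂ hcov ↦ ?_
    have hT : (Set.univ : Set T.left) ⊆ ((vanishingIdeal Z).subschemeι ≫ (fst T P).left) '' Z₁ ∪ ((vanishingIdeal Z).subschemeι ≫ (fst T P).left) '' Z₂ := by
      rintro t -
      obtain ⟨g, rfl⟩ := hsurj.1 t
      rcases hcov (Set.mem_univ g) with h | h
      · exact Or.inl ⟨g, h, rfl⟩
      · exact Or.inr ⟨g, h, rfl⟩
    rcases isPreirreducible_iff_isClosed_union_isClosed.mp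
        (IrreducibleSpace.isIrreducible_univ (X := ↥T.left)).isPreirreducible _ _
        ((((vanishingIdeal Z).subschemeι ≫ (fst T P).left)).isClosedMap _ hZ₁) ((((vanishingIdeal Z).subschemeι ≫ (fst T P).left)).isClosedMap _ hZ₂) hT with h | h
    · exact Or.inl (eq_univ_of_isClosed_of_image_eq Z φ₀ hΓφ hZ₁
        (Set.eq_univ_of_univ_subset h)).symm.subset
    · exact Or.inr (eq_univ_of_isClosed_of_image_eq Z φ₀ hΓφ hZ₂
        (Set.eq_univ_of_univ_subset h)).symm.subset
  exact @IrreducibleSpace.mk _ _ ⟨hpre⟩ ⟨g₀⟩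

include hΓφ in
/-- `G` is integral. [folklore] -/
theorem isIntegral_grS [IsIntegral T.left] [LocallyOfFiniteType T.hom] [IsProper P.hom] :
    IsIntegral ((vanishingIdeal Z).subscheme) :=
  haveI := irreducibleSpace_grS Z φ₀ hΓφ
  haveI := Resolution.ComponentGluing.isReduced_subscheme_vanishingIdeal Z
  isIntegral_of_irreducibleSpace_of_isReduced _

omit [IsAlgClosed K] in
/-- The point of a `K`-point `q : Spec K → X` over `K` is closed. [folklore] -/
theorem isClosed_singleton_apply_of_comp_eq_id {X : Scheme.{u}} (h : X ⟶ Spec (.of K))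
    (q : Spec (.of K) ⟶ X) (hq : q ≫ h = 𝟙 _) :
    IsClosed ({q (IsLocalRing.closedPoint K)} : Set X) := by
  haveI := isClosedImmersion_of_comp_eq_id h q hq
  have hr : Set.range q = {q (IsLocalRing.closedPoint K)} := by
    ext z
    constructor
    · rintro ⟨a, rfl⟩
      rw [Subsingleton.elim a (IsLocalRing.closedPoint K)]
      rfl
    · rintro rfl
      exact ⟨_, rfl⟩
  rw [← hr]
  exact q.isClosedEmbedding.isClosed_range

include hΓφ in
/-- The diagonal of `π : G → T` is surjective: its closed image contains every closed point of
`G ×_T G`, whose two projections are `K`-points of `G` over the same point of `T`. [folklore] -/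
theorem surjective_diagonal_grπ [LocallyOfFiniteType T.hom] [IsProper P.hom] :
    Surjective (pullback.diagonal (((vanishingIdeal Z).subschemeι ≫ (fst T P).left))) := by
  haveI := isFinite_grπ Z φ₀ hΓφ
  haveI := isProper_grπ Z
  let sD : pullback (((vanishingIdeal Z).subschemeι ≫ (fst T P).left)) (((vanishingIdeal Z).subschemeι ≫ (fst T P).left)) ⟶ Spec (.of K) :=
    pullback.fst (((vanishingIdeal Z).subschemeι ≫ (fst T P).left)) (((vanishingIdeal Z).subschemeι ≫ (fst T P).left)) ≫ ((vanishingIdeal Z).subschemeι ≫ (T ⊗ P).hom)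
  haveI : LocallyOfFiniteType sD := by
    change LocallyOfFiniteType (pullback.fst (((vanishingIdeal Z).subschemeι ≫ (fst T P).left)) (((vanishingIdeal Z).subschemeι ≫ (fst T P).left)) ≫ ((vanishingIdeal Z).subschemeι ≫ (T ⊗ P).hom))
    infer_instance
  haveI : JacobsonSpace ↥(pullback (((vanishingIdeal Z).subschemeι ≫ (fst T P).left)) (((vanishingIdeal Z).subschemeι ≫ (fst T P).left))) := LocallyOfFiniteType.jacobsonSpace sD
  have hcl : IsClosed (Set.range (pullback.diagonal (((vanishingIdeal Z).subschemeι ≫ (fst T P).left)))) :=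
    (pullback.diagonal (((vanishingIdeal Z).subschemeι ≫ (fst T P).left))).isClosedEmbedding.isClosed_range
  have hsub : closedPoints ↥(pullback (((vanishingIdeal Z).subschemeι ≫ (fst T P).left)) (((vanishingIdeal Z).subschemeι ≫ (fst T P).left))) ⊆
      Set.range (pullback.diagonal (((vanishingIdeal Z).subschemeι ≫ (fst T P).left))) := fun w hw ↦ by
    have hwcl : IsClosed ({w} : Set _) := mem_closedPoints_iff.mp hw
    set ω := pointOfClosedPoint sD w hwcl with hω
    have hω1 : ω ≫ sD = 𝟙 _ := pointOfClosedPoint_comp sD w hwcl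
    set g₁ := ω ≫ pullback.fst (((vanishingIdeal Z).subschemeι ≫ (fst T P).left)) (((vanishingIdeal Z).subschemeι ≫ (fst T P).left)) with hg₁
    set g₂ := ω ≫ pullback.snd (((vanishingIdeal Z).subschemeι ≫ (fst T P).left)) (((vanishingIdeal Z).subschemeι ≫ (fst T P).left)) with hg₂
    have hg₁K : g₁ ≫ ((vanishingIdeal Z).subschemeι ≫ (T ⊗ P).hom) = 𝟙 _ := by rw [hg₁, Category.assoc]; exact hω1
    have hg₂K : g₂ ≫ ((vanishingIdeal Z).subschemeι ≫ (T ⊗ P).hom) = 𝟙 _ := by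
      rw [hg₂, Category.assoc, ← grπ_comp_hom, ← Category.assoc (pullback.snd _ _),
        ← pullback.condition, Category.assoc, grπ_comp_hom, ← Category.assoc]
      exact hω1
    have hπ : ((vanishingIdeal Z).subschemeι ≫ (fst T P).left) (g₁ (IsLocalRing.closedPoint K)) = ((vanishingIdeal Z).subschemeι ≫ (fst T P).left) (g₂ (IsLocalRing.closedPoint K)) := by
      rw [← Scheme.Hom.comp_apply, ← Scheme.Hom.comp_apply, hg₁, hg₂, Category.assoc,
        Category.assoc, pullback.condition]
    have h₁cl : IsClosed ({g₁ (IsLocalRing.closedPoint K)} : Set ↥((vanishingIdeal Z).subscheme)) :=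
      isClosed_singleton_apply_of_comp_eq_id _ g₁ hg₁K
    have htcl : IsClosed ({((vanishingIdeal Z).subschemeι ≫ (fst T P).left) (g₁ (IsLocalRing.closedPoint K))} : Set T.left) := by
      rw [← Set.image_singleton]; exact (((vanishingIdeal Z).subschemeι ≫ (fst T P).left)).isClosedMap _ h₁cl
    have hpt : g₁ (IsLocalRing.closedPoint K) = g₂ (IsLocalRing.closedPoint K) :=
      subsingleton_preimage_grπ Z φ₀ hΓφ htcl (Set.mem_singleton _) hπ.symm
    have hg : g₁ = g₂ := ext_of_apply_closedPoint_eq (((vanishingIdeal Z).subschemeι ≫ (T ⊗ P).hom)) hg₁K hg₂K hpt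
    have hωΔ : ω = g₁ ≫ pullback.diagonal (((vanishingIdeal Z).subschemeι ≫ (fst T P).left)) := by
      apply pullback.hom_ext
      · rw [Category.assoc, pullback.diagonal_fst, Category.comp_id]
      · rw [Category.assoc, pullback.diagonal_snd, Category.comp_id, ← hg₂, ← hg]
    refine ⟨g₁ (IsLocalRing.closedPoint K), ?_⟩
    rw [← Scheme.Hom.comp_apply, ← hωΔ, hω, pointOfClosedPoint_apply]
  refine ⟨fun w ↦ ?_⟩
  have : Set.range (pullback.diagonal (((vanishingIdeal Z).subschemeι ≫ (fst T P).left))) = Set.univ := by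
    apply Set.eq_univ_of_univ_subset
    rw [← closure_closedPoints (X := ↥(pullback (((vanishingIdeal Z).subschemeι ≫ (fst T P).left)) (((vanishingIdeal Z).subschemeι ≫ (fst T P).left))))]
    exact closure_minimal hsub hcl
  have hw : w ∈ Set.range (pullback.diagonal (((vanishingIdeal Z).subschemeι ≫ (fst T P).left))) := this ▸ Set.mem_univ w
  exact hw

omit [IsAlgClosed K] in
/-- The residue fields of a scheme over a field of characteristic zero have characteristic zero. [folklore] -/
theorem charZero_residueField [CharZero K] (X : SchemeOver K) (x : X.left) :
    CharZero (X.left.residueField x) := by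
  let φ := Spec.preimage (X.left.fromSpecResidueField x ≫ X.hom)
  exact charZero_of_injective_ringHom (f := φ.hom) φ.hom.injective

include hΓφ in
/-- The stalk map of `π : G → T` at the generic point — the extension of function fields
`K(T) → K(G)` — is an isomorphism: `π` is universally injective (surjective diagonal), so the
extension is purely inseparable (Stacks 01S4), hence trivial in characteristic zero. [folklore] -/
theorem isIso_stalkMap_grπ_genericPoint [CharZero K] [IsIntegral T.left] [LocallyOfFiniteType T.hom]
    [IsProper P.hom] :
    haveI := isIntegral_grS Z φ₀ hΓφ
    IsIso ((((vanishingIdeal Z).subschemeι ≫ (fst T P).left)).stalkMap (genericPoint ↥((vanishingIdeal Z).subscheme))) := by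
  haveI := isIntegral_grS Z φ₀ hΓφ
  haveI := isFinite_grπ Z φ₀ hΓφ
  haveI : IsDominant (((vanishingIdeal Z).subschemeι ≫ (fst T P).left)) := by
    haveI := surjective_grπ Z φ₀ hΓφ; infer_instance
  set ξ := genericPoint ↥((vanishingIdeal Z).subscheme) with hξ
  -- universally injective, hence purely inseparable residue field extensions
  have hUI : UniversallyInjective (((vanishingIdeal Z).subschemeι ≫ (fst T P).left)) :=
    ((tfae_universallyInjective (((vanishingIdeal Z).subschemeι ≫ (fst T P).left))).out 0 3).mpr (surjective_diagonal_grπ Z φ₀ hΓφ)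
  have h3 : Function.Injective (((vanishingIdeal Z).subschemeι ≫ (fst T P).left)) ∧
      ∀ x, ((((vanishingIdeal Z).subschemeι ≫ (fst T P).left)).residueFieldMap x).hom.IsPurelyInseparable :=
    ((tfae_universallyInjective (((vanishingIdeal Z).subschemeι ≫ (fst T P).left))).out 0 2).mp hUI
  have hPI : ((((vanishingIdeal Z).subschemeι ≫ (fst T P).left)).residueFieldMap ξ).hom.IsPurelyInseparable := h3.2 ξ
  -- in characteristic zero the residue field map is surjective
  have hsurjκ : Function.Surjective ((((vanishingIdeal Z).subschemeι ≫ (fst T P).left)).residueFieldMap ξ) := by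
    letI := ((((vanishingIdeal Z).subschemeι ≫ (fst T P).left)).residueFieldMap ξ).hom.toAlgebra
    haveI : IsPurelyInseparable (T.left.residueField (((vanishingIdeal Z).subschemeι ≫ (fst T P).left) ξ)) (((vanishingIdeal Z).subscheme).residueField ξ) := hPI
    haveI : CharZero (T.left.residueField (((vanishingIdeal Z).subschemeι ≫ (fst T P).left) ξ)) := charZero_residueField T _
    exact IsPurelyInseparable.surjective_algebraMap_of_isSeparable
      (T.left.residueField (((vanishingIdeal Z).subschemeι ≫ (fst T P).left) ξ)) (((vanishingIdeal Z).subscheme).residueField ξ)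
  -- both stalks are fields, so the residue maps are bijective and the stalk map is surjective
  have hηT : ((vanishingIdeal Z).subschemeι ≫ (fst T P).left) ξ = genericPoint ↥T.left := Resolution.genericPoint_eq_of_isDominant _
  have hFT : IsField (T.left.presheaf.stalk (((vanishingIdeal Z).subschemeι ≫ (fst T P).left) ξ)) := by
    rw [hηT]; exact Field.toIsField ↥T.left.functionField
  have hFG : IsField (((vanishingIdeal Z).subscheme).presheaf.stalk ξ) := Field.toIsField ↥((vanishingIdeal Z).subscheme).functionField
  have hinjG : Function.Injective (((vanishingIdeal Z).subscheme).residue ξ) := by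
    change Function.Injective (IsLocalRing.residue _)
    rw [injective_iff_map_eq_zero]
    intro a ha
    rw [IsLocalRing.residue_eq_zero_iff, (IsLocalRing.isField_iff_maximalIdeal_eq.mp hFG)] at ha
    exact ha
  have hsurj : Function.Surjective ((((vanishingIdeal Z).subschemeι ≫ (fst T P).left)).stalkMap ξ) := fun b ↦ by
    obtain ⟨c, hc⟩ := hsurjκ (((vanishingIdeal Z).subscheme).residue ξ b)
    obtain ⟨a, rfl⟩ := (T.left.residue_surjective (((vanishingIdeal Z).subschemeι ≫ (fst T P).left) ξ)) c
    refine ⟨a, hinjG ?_⟩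
    rw [← CategoryTheory.comp_apply, ← Scheme.residue_residueFieldMap, CategoryTheory.comp_apply]
    exact hc
  have hinj : Function.Injective ((((vanishingIdeal Z).subschemeι ≫ (fst T P).left)).stalkMap ξ) := by
    letI := hFT.toField
    exact RingHom.injective _
  exact (ConcreteCategory.isIso_iff_bijective _).mpr ⟨hinj, hsurj⟩

include hΓφ in
/-- **`π : G → T` is an isomorphism** for `T` normal (Zariski: finite, birational onto a normal
scheme). [folklore] -/
theorem isIso_grπ [CharZero K] [IsIntegral T.left] [LocallyOfFiniteType T.hom] [IsProper P.hom]
    (hTn : ∀ t : T.left, IsIntegrallyClosed (T.left.presheaf.stalk t)) : IsIso (((vanishingIdeal Z).subschemeι ≫ (fst T P).left)) := by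
  haveI := isIntegral_grS Z φ₀ hΓφ
  haveI := isFinite_grπ Z φ₀ hΓφ
  haveI : IsDominant (((vanishingIdeal Z).subschemeι ≫ (fst T P).left)) := by
    haveI := surjective_grπ Z φ₀ hΓφ; infer_instance
  have hstalk := isIso_stalkMap_grπ_genericPoint Z φ₀ hΓφ
  have key : MorphismProperty.isomorphisms Scheme (((vanishingIdeal Z).subschemeι ≫ (fst T P).left)) := by
    refine (IsZariskiLocalAtTarget.iff_of_iSup_eq_top
      (P := MorphismProperty.isomorphisms Scheme) _ (Resolution.iSup_nonempty_affineOpens_eq_top T.left)).mpr ?_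
    rintro ⟨V, hVne⟩
    show IsIso (((vanishingIdeal Z).subschemeι ≫ (fst T P).left) ∣_ (V : T.left.Opens))
    haveI := hVne
    exact Resolution.isIso_morphismRestrict_of_isIntegralHom_of_isIso_stalkMap (((vanishingIdeal Z).subschemeι ≫ (fst T P).left)) hTn hstalk V
  exact key

omit [IsAlgClosed K] in
include hΓφ in
/-- The `K`-point `(x, φ₀ x)` of `T ×_K P` factors through `G`. [folklore] -/
theorem exists_comp_grι_eq [LocallyOfFiniteType T.hom] [LocallyOfFiniteType P.hom] (x : AlgPoints T K) :
    ∃ g : (specOver K K).left ⟶ (vanishingIdeal Z).subscheme, g ≫ (vanishingIdeal Z).subschemeι = (lift x (φ₀ x) : AlgPoints (T ⊗ P) K).left := by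
  haveI : Unique ↥(specOver K K).left := inferInstanceAs (Unique (PrimeSpectrum K))
  haveI : IsReduced (specOver K K).left := inferInstanceAs (IsReduced (Spec (.of K)))
  haveI := Resolution.ComponentGluing.isReduced_subscheme_vanishingIdeal Z
  have hmem : AlgPoints.pt (lift x (φ₀ x) : AlgPoints (T ⊗ P) K) ∈ (Z : Set ↥(T ⊗ P).left) :=
    (hΓφ x _).mpr rfl
  have hrange : Set.range (lift x (φ₀ x) : AlgPoints (T ⊗ P) K).left ⊆ closure (Set.range ((vanishingIdeal Z).subschemeι)) := by
    rw [Resolution.ComponentGluing.range_subschemeι_vanishingIdeal Z, Z.isClosed.closure_eq]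
    rintro _ ⟨a, rfl⟩
    rw [Subsingleton.elim a (IsLocalRing.closedPoint K)]
    exact hmem
  exact ⟨IsClosedImmersion.lift ((vanishingIdeal Z).subschemeι) _
    (Scheme.Hom.ker_le_ker_of_range_subset_closure _ _ hrange), IsClosedImmersion.lift_fac _ _ _⟩

end ClosedGraph

/-! ### The theorem -/

section Main

variable {K : Type u} [Field K] [IsAlgClosed K] [CharZero K] {T P : SchemeOver K}
  [IsIntegral T.left] [LocallyOfFiniteType T.hom] [IsProper P.hom]

open ClosedGraph in
/-- **A closed graph is the graph of a morphism** (normal source, proper target, characteristic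
zero). Let `K` be an algebraically closed field of characteristic zero, `T` an integral normal
`K`-scheme locally of finite type, `P` a proper `K`-scheme, `φ₀ : T(K) → P(K)` a map on `K`-points
and `Γ ⊆ T ×_K P` a closed subset whose `K`-points are exactly the pairs `(x, φ₀ x)`. Then `φ₀`
is induced by a (unique, `SchemeOver.hom_ext_of_forall_algPoints`) morphism `ψ : T → P` of
`K`-schemes.
Proof: the reduced closed subscheme `G` on `Γ` is finite over `T` (proper with one point over each
closed point), integral, and universally injective over `T` (its diagonal hits every closed point),
so `K(T) → K(G)` is purely inseparable, hence an isomorphism in characteristic zero, and `G → T`,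
finite and birational onto the normal `T`, is an isomorphism (Zariski's Main Theorem); `ψ` is
`T ≅ G ↪ T ×_K P → P`. In positive characteristic the graph of `x ↦ x^{1/p}` is a counterexample.
[cite: MumfordAV1970, §4 (morphisms of varieties are determined by, and — with closed graph over a normal variety in characteristic 0 — defined by their effect on points)] -/
theorem exists_hom_forall_comp_eq_of_isClosed
    (hTn : ∀ t : T.left, IsIntegrallyClosed (T.left.presheaf.stalk t))
    (Γ : Set ↥(T ⊗ P).left) (hΓ : IsClosed Γ) (φ₀ : AlgPoints T K → AlgPoints P K)
    (hΓφ : ∀ (x : AlgPoints T K) (y : AlgPoints P K),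
      AlgPoints.pt (lift x y : AlgPoints (T ⊗ P) K) ∈ Γ ↔ y = φ₀ x) :
    ∃ ψ : T ⟶ P, ∀ x : AlgPoints T K, x ≫ ψ = φ₀ x := by
  set Z : Closeds ↥(T ⊗ P).left := ⟨Γ, hΓ⟩ with hZ
  replace hΓφ : ∀ (x : AlgPoints T K) (y : AlgPoints P K),
      AlgPoints.pt (lift x y : AlgPoints (T ⊗ P) K) ∈ (Z : Set ↥(T ⊗ P).left) ↔ y = φ₀ x := hΓφ
  haveI := isIso_grπ Z φ₀ hΓφ hTn
  have hw : (inv (((vanishingIdeal Z).subschemeι ≫ (fst T P).left)) ≫ (vanishingIdeal Z).subschemeι ≫ (snd T P).left) ≫ P.hom = T.hom := by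
    rw [Category.assoc, Category.assoc, Over.w (snd T P)]
    rw [← grπ_comp_hom, IsIso.inv_hom_id_assoc]
  refine ⟨Over.homMk (inv (((vanishingIdeal Z).subschemeι ≫ (fst T P).left)) ≫ (vanishingIdeal Z).subschemeι ≫ (snd T P).left) hw, fun x ↦ ?_⟩
  obtain ⟨g, hg⟩ := exists_comp_grι_eq Z φ₀ hΓφ x
  have hgπ : g ≫ ((vanishingIdeal Z).subschemeι ≫ (fst T P).left) = x.left := by
    rw [← Category.assoc, hg]
    exact congrArg CommaMorphism.left (lift_fst x (φ₀ x))
  ext : 1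
  change x.left ≫ inv (((vanishingIdeal Z).subschemeι ≫ (fst T P).left)) ≫ (vanishingIdeal Z).subschemeι ≫ (snd T P).left = (φ₀ x).left
  rw [← hgπ, Category.assoc, IsIso.hom_inv_id_assoc, ← Category.assoc, hg]
  exact congrArg CommaMorphism.left (lift_snd x (φ₀ x))

end Main

end Literature.AlgebraicGeometry.Motives
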